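import Mathlib
import HarnessLib
import Summits.ValiantsHypothesis.ValiantsHypothesis.Theorems.EquivariantDialLayersBlockWitness

/-!
# Equivariant dial, layered face — symmetrisers of quadrics land in the cheap ideal `𝔠_m`   [this file]

Support for the cell `A = EqHardBiPerm` (item `stmt-ValiantsHypothesis-23702`, draft route `SymmetryDial`), layered leaf
`R^lay = IdealWidthSuperpoly`, step `[I1]` of the road `[I1] → [I2] → [I3]`.  HONEST FRAMING: `VP ≠ VNP` is NOT proved here,
nor `A`, nor `R^lay`, nor any width inequality; `span(C_m) =` cheap component is NOT claimed.  What is certified, at the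
level of SYMMETRISERS and for every quadric `v` (`IsHomogeneous v 2`): `∑_{τ ∈ 𝔖_m} (1 × τ) · v ∈ 𝔠_m` (`colSym_mem_cheapIdeal`)
and `∑_{σ ∈ 𝔖_m} (σ × 1) · v ∈ 𝔠_m` (`rowSym_mem_cheapIdeal`), where `𝔠_m = (t_a, s_b, x_{a,b}², (XXᵀ)_{i,k}, (XᵀX)_{j,l})` is
`EquivariantDialLayersBlockWitness.cheapIdeal`; i.e. `𝔠_m` contains the isotypic pieces of the quadrics `R_2` of the types
`λ ⊠ (m)`, `(m) ⊠ μ` (the companion file `EquivariantDialLayersStabilisers` adds `(m-1,1) ⊠ (m-1,1)`).  REFINEMENT (exact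
instrument, `m ≤ 7`): `𝔠_m ∩ R_2` is STRICTLY LARGER than the cheap isotypic component — it also holds one copy each of
`S⊠P, P⊠S, S⊠Q, Q⊠S` (`S = (m-1,1)`, `P = (m-2,2)`, `Q = (m-2,1,1)`); only `⊇` is used on the road.  RESTATED `[I3]` TARGET
(paper until `[I2]`, `[I3]` land): every `𝔖_m × 𝔖_m`-stable `V ⊆ R_2` with `per_m ∈ (V)` has an irreducible constituent `W`
with `W ∩ (𝔠_m ∩ R_2) = 0` (`BlockWitness.exists_not_mem_cheapIdeal_of_hasIdealWidthLE`), hence of non-cheap type, hence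
`dim V ≥ (m-1)m(m-3)/2` for `m = pq`, `p, q ≥ 3`.
MECHANISM [folklore orbit-sum / averaging identities over `ℂ` (char 0 used: division by `m - 1`)].  One-point orbit sums
`∑_τ G(τ b) = #Stab(b) • ∑_l G(l)` (`sum_perm_apply_eq_card_smul`, by `Finset.sum_comp` and equal fibres) make the column
average of `x_{a,b} x_{c,b}` a multiple of `(XXᵀ)_{a,c}`; for `b ≠ d` the AVERAGING TRICK
`(m-1) • A(x_{ab} x_{cd}) = ∑_{d' ≠ b} A(x_{ab} x_{cd'}) = A(x_{ab} (t_c - x_{cb}))` (the average is invariant under the column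
transposition `(d d')`) lands in `𝔠_m`.  General quadrics by `Submodule.span_induction` (`mem_span_X_mul_X`); rows from
columns by transposition.  0 named facts, 0 `def … : Prop`, 0 instances, 0 sorry; 3 small data definitions
(`stab`, `colAvg`, `rowAvg`).
-/

set_option linter.dupNamespace false

namespace Summit.ValiantsHypothesis.ValiantsHypothesis.Theorems.EquivariantDialLayersSymmetrisers

open MvPolynomial
open Equiv (Perm)
open Summit.ValiantsHypothesis.ValiantsHypothesis.Theorems.EquivariantDialLayersBlockWitness

variable {m : ℕ}

/-! ## §1 Orbit sums over `𝔖_m` and over a point stabiliser -/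

/-- `∑_{τ ∈ 𝔖_m} G(τ b) = #Stab(b) • ∑_l G(l)`. -/
theorem sum_perm_apply_eq_card_smul {M : Type*} [AddCommMonoid M] (b : Fin m) (G : Fin m → M) :
    ∑ τ : Perm (Fin m), G (τ b) = (Finset.univ.filter fun τ : Perm (Fin m) => τ b = b).card • ∑ l, G l := by
  classical
  rw [Finset.sum_comp G (fun τ : Perm (Fin m) => τ b)]
  have himg : Finset.univ.image (fun τ : Perm (Fin m) => τ b) = Finset.univ :=
    Finset.eq_univ_iff_forall.2 fun l =>
      Finset.mem_image.2 ⟨Equiv.swap b l, Finset.mem_univ _, Equiv.swap_apply_left b l⟩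
  rw [himg, Finset.smul_sum]
  refine Finset.sum_congr rfl fun l _ => ?_
  congr 1
  refine Finset.card_bij' (fun τ _ => Equiv.swap b l * τ) (fun τ _ => Equiv.swap b l * τ) ?_ ?_ ?_ ?_
  · intro τ hτ
    rw [Finset.mem_filter] at hτ ⊢
    exact ⟨Finset.mem_univ _, by rw [Equiv.Perm.mul_apply, hτ.2, Equiv.swap_apply_right]⟩
  · intro τ hτ
    rw [Finset.mem_filter] at hτ ⊢
    exact ⟨Finset.mem_univ _, by rw [Equiv.Perm.mul_apply, hτ.2, Equiv.swap_apply_left]⟩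
  all_goals exact fun τ _ => Equiv.swap_mul_self_mul b l τ

/-- The point stabiliser `Stab(j) = {τ ∈ 𝔖_m : τ j = j}` as a `Finset`. -/
def stab (j : Fin m) : Finset (Perm (Fin m)) := Finset.univ.filter fun τ => τ j = j

/-- Membership in `Stab(j)`. -/
theorem mem_stab {j : Fin m} {τ : Perm (Fin m)} : τ ∈ stab j ↔ τ j = j := by
  simp [stab]

/-- `∑_{τ ∈ Stab(j)} G(τ d) = #Stab(j, d) • ∑_{l ≠ j} G(l)` for `d ≠ j`. -/
theorem sum_stab_apply_eq_card_smul {M : Type*} [AddCommMonoid M] {j d : Fin m} (hd : d ≠ j) (G : Fin m → M) :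
    ∑ τ ∈ stab j, G (τ d) = ((stab j).filter fun τ => τ d = d).card • ∑ l ∈ Finset.univ.erase j, G l := by
  classical
  rw [Finset.sum_comp G (fun τ : Perm (Fin m) => τ d)]
  have himg : (stab j).image (fun τ : Perm (Fin m) => τ d) = Finset.univ.erase j := by
    ext l
    simp only [Finset.mem_image, mem_stab, Finset.mem_erase, Finset.mem_univ, and_true]
    constructor
    · rintro ⟨τ, hτ, rfl⟩
      exact fun h => hd (τ.injective (h.trans hτ.symm))
    · intro hl
      exact ⟨Equiv.swap d l, Equiv.swap_apply_of_ne_of_ne hd.symm (Ne.symm hl), Equiv.swap_apply_left d l⟩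
  rw [himg, Finset.smul_sum]
  refine Finset.sum_congr rfl fun l hl => ?_
  have hlj : l ≠ j := (Finset.mem_erase.1 hl).1
  congr 1
  refine Finset.card_bij' (fun τ _ => Equiv.swap d l * τ) (fun τ _ => Equiv.swap d l * τ) ?_ ?_ ?_ ?_
  · intro τ hτ
    simp only [Finset.mem_filter, mem_stab, Equiv.Perm.mul_apply] at hτ ⊢
    exact ⟨by rw [hτ.1, Equiv.swap_apply_of_ne_of_ne hd.symm hlj.symm],
      by rw [hτ.2, Equiv.swap_apply_right]⟩
  · intro τ hτ
    simp only [Finset.mem_filter, mem_stab, Equiv.Perm.mul_apply] at hτ ⊢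
    exact ⟨by rw [hτ.1, Equiv.swap_apply_of_ne_of_ne hd.symm hlj.symm],
      by rw [hτ.2, Equiv.swap_apply_left]⟩
  all_goals exact fun τ _ => Equiv.swap_mul_self_mul d l τ

/-! ## §2 The cheap ideal is stable under the window `𝔖_m × 𝔖_m` and under transposition -/

/-- `(σ × τ) · x_{a,b} = x_{σ a, τ b}`. -/
theorem rename_prodCongr_X (σ τ : Perm (Fin m)) (a b : Fin m) :
    rename (Equiv.prodCongr σ τ) (X (a, b) : MvPolynomial (Fin m × Fin m) ℂ) = X (σ a, τ b) := by
  rw [rename_X]; rfl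

/-- `(1 × τ) · x_{a,b} = x_{a, τ b}`. -/
theorem rename_one_prodCongr_X (τ : Perm (Fin m)) (a b : Fin m) :
    rename (Equiv.prodCongr (1 : Perm (Fin m)) τ) (X (a, b) : MvPolynomial (Fin m × Fin m) ℂ) = X (a, τ b) := by
  rw [rename_X]; rfl

/-- Transposition: `x_{a,b} ↦ x_{b,a}`. -/
theorem rename_prodComm_X (a b : Fin m) :
    rename (Equiv.prodComm (Fin m) (Fin m)) (X (a, b) : MvPolynomial (Fin m × Fin m) ℂ) = X (b, a) := by
  rw [rename_X]; rfl

/-- An algebra endomorphism mapping the five generating families of `𝔠_m` into `𝔠_m` maps `𝔠_m` into itself. -/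
theorem map_mem_cheapIdeal (φ : MvPolynomial (Fin m × Fin m) ℂ →ₐ[ℂ] MvPolynomial (Fin m × Fin m) ℂ)
    (h₁ : ∀ a, φ (rowSum (Fin m) a) ∈ cheapIdeal (Fin m)) (h₂ : ∀ b, φ (colSum (Fin m) b) ∈ cheapIdeal (Fin m))
    (h₃ : ∀ ab : Fin m × Fin m, φ (X ab ^ 2) ∈ cheapIdeal (Fin m))
    (h₄ : ∀ i k, φ (rowGram (Fin m) i k) ∈ cheapIdeal (Fin m))
    (h₅ : ∀ j l, φ (colGram (Fin m) j l) ∈ cheapIdeal (Fin m))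
    {f : MvPolynomial (Fin m × Fin m) ℂ} (hf : f ∈ cheapIdeal (Fin m)) : φ f ∈ cheapIdeal (Fin m) := by
  have key : cheapIdeal (Fin m) ≤ (cheapIdeal (Fin m)).comap φ := by
    rw [cheapIdeal, Ideal.span_le]
    rintro g ((((⟨a, rfl⟩ | ⟨b, rfl⟩) | ⟨ab, rfl⟩) | ⟨ik, rfl⟩) | ⟨jl, rfl⟩)
    exacts [h₁ a, h₂ b, h₃ ab, h₄ ik.1 ik.2, h₅ jl.1 jl.2]
  exact key hf

/-- `𝔠_m` is stable under `(σ × τ)` for all `σ, τ ∈ 𝔖_m`. -/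
theorem rename_prodCongr_mem_cheapIdeal (σ τ : Perm (Fin m)) {f : MvPolynomial (Fin m × Fin m) ℂ}
    (hf : f ∈ cheapIdeal (Fin m)) : rename (Equiv.prodCongr σ τ) f ∈ cheapIdeal (Fin m) := by
  refine map_mem_cheapIdeal _ (fun a => ?_) (fun b => ?_) (fun ab => ?_) (fun i k => ?_) (fun j l => ?_) hf
  · rw [show rename (Equiv.prodCongr σ τ) (rowSum (Fin m) a) = rowSum (Fin m) (σ a) from by
      simp only [rowSum, map_sum, rename_prodCongr_X]; exact Equiv.sum_comp τ (fun b => X (σ a, b))]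
    exact rowSum_mem (σ a)
  · rw [show rename (Equiv.prodCongr σ τ) (colSum (Fin m) b) = colSum (Fin m) (τ b) from by
      simp only [colSum, map_sum, rename_prodCongr_X]; exact Equiv.sum_comp σ (fun a => X (a, τ b))]
    exact colSum_mem (τ b)
  · rw [map_pow, rename_X]; exact X_sq_mem _
  · rw [show rename (Equiv.prodCongr σ τ) (rowGram (Fin m) i k) = rowGram (Fin m) (σ i) (σ k) from by
      simp only [rowGram, map_sum, map_mul, rename_prodCongr_X]
      exact Equiv.sum_comp τ (fun j => X (σ i, j) * X (σ k, j))]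
    exact rowGram_mem _ _
  · rw [show rename (Equiv.prodCongr σ τ) (colGram (Fin m) j l) = colGram (Fin m) (τ j) (τ l) from by
      simp only [colGram, map_sum, map_mul, rename_prodCongr_X]
      exact Equiv.sum_comp σ (fun i => X (i, τ j) * X (i, τ l))]
    exact colGram_mem _ _

/-- `𝔠_m` is stable under transposition `x_{a,b} ↦ x_{b,a}`. -/
theorem rename_prodComm_mem_cheapIdeal {f : MvPolynomial (Fin m × Fin m) ℂ} (hf : f ∈ cheapIdeal (Fin m)) :
    rename (Equiv.prodComm (Fin m) (Fin m)) f ∈ cheapIdeal (Fin m) := by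
  refine map_mem_cheapIdeal _ (fun a => ?_) (fun b => ?_) (fun ab => ?_) (fun i k => ?_) (fun j l => ?_) hf
  · rw [show rename (Equiv.prodComm (Fin m) (Fin m)) (rowSum (Fin m) a) = colSum (Fin m) a from by
      simp only [rowSum, colSum, map_sum, rename_prodComm_X]]
    exact colSum_mem a
  · rw [show rename (Equiv.prodComm (Fin m) (Fin m)) (colSum (Fin m) b) = rowSum (Fin m) b from by
      simp only [rowSum, colSum, map_sum, rename_prodComm_X]]
    exact rowSum_mem b
  · rw [map_pow, rename_X]; exact X_sq_mem _
  · rw [show rename (Equiv.prodComm (Fin m) (Fin m)) (rowGram (Fin m) i k) = colGram (Fin m) i k from by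
      simp only [rowGram, colGram, map_sum, map_mul, rename_prodComm_X]]
    exact colGram_mem _ _
  · rw [show rename (Equiv.prodComm (Fin m) (Fin m)) (colGram (Fin m) j l) = rowGram (Fin m) j l from by
      simp only [rowGram, colGram, map_sum, map_mul, rename_prodComm_X]]
    exact rowGram_mem _ _

/-- Division by a nonzero scalar inside `𝔠_m`. -/
theorem mem_cheapIdeal_of_smul_mem {c : ℂ} (hc : c ≠ 0) {x : MvPolynomial (Fin m × Fin m) ℂ}
    (h : c • x ∈ cheapIdeal (Fin m)) : x ∈ cheapIdeal (Fin m) := by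
  rw [← inv_smul_smul₀ hc x]
  exact Submodule.smul_of_tower_mem _ c⁻¹ h

/-! ## §3 Row and column averaging operators -/

/-- `A_T = ∑_{τ ∈ T} (1 × τ)`: averaging over a set of COLUMN permutations. -/
noncomputable def colAvg (T : Finset (Perm (Fin m))) :
    MvPolynomial (Fin m × Fin m) ℂ →ₗ[ℂ] MvPolynomial (Fin m × Fin m) ℂ :=
  ∑ τ ∈ T, (rename (Equiv.prodCongr (1 : Perm (Fin m)) τ)).toLinearMap

/-- `B_S = ∑_{σ ∈ S} (σ × 1)`: averaging over a set of ROW permutations. -/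
noncomputable def rowAvg (S : Finset (Perm (Fin m))) :
    MvPolynomial (Fin m × Fin m) ℂ →ₗ[ℂ] MvPolynomial (Fin m × Fin m) ℂ :=
  ∑ σ ∈ S, (rename (Equiv.prodCongr σ (1 : Perm (Fin m)))).toLinearMap

/-- `A_T f = ∑_{τ ∈ T} (1 × τ) · f`. -/
theorem colAvg_apply (T : Finset (Perm (Fin m))) (f : MvPolynomial (Fin m × Fin m) ℂ) :
    colAvg T f = ∑ τ ∈ T, rename (Equiv.prodCongr (1 : Perm (Fin m)) τ) f := by
  simp only [colAvg, LinearMap.coe_sum, Finset.sum_apply, AlgHom.toLinearMap_apply]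

/-- `B_S f = ∑_{σ ∈ S} (σ × 1) · f`. -/
theorem rowAvg_apply (S : Finset (Perm (Fin m))) (f : MvPolynomial (Fin m × Fin m) ℂ) :
    rowAvg S f = ∑ σ ∈ S, rename (Equiv.prodCongr σ (1 : Perm (Fin m))) f := by
  simp only [rowAvg, LinearMap.coe_sum, Finset.sum_apply, AlgHom.toLinearMap_apply]

/-- `A_T` preserves `𝔠_m`. -/
theorem colAvg_mem (T : Finset (Perm (Fin m))) {f : MvPolynomial (Fin m × Fin m) ℂ} (hf : f ∈ cheapIdeal (Fin m)) :
    colAvg T f ∈ cheapIdeal (Fin m) := by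
  rw [colAvg_apply]
  exact Ideal.sum_mem _ fun τ _ => rename_prodCongr_mem_cheapIdeal 1 τ hf

/-- `B_S` preserves `𝔠_m`. -/
theorem rowAvg_mem (S : Finset (Perm (Fin m))) {f : MvPolynomial (Fin m × Fin m) ℂ} (hf : f ∈ cheapIdeal (Fin m)) :
    rowAvg S f ∈ cheapIdeal (Fin m) := by
  rw [rowAvg_apply]
  exact Ideal.sum_mem _ fun σ _ => rename_prodCongr_mem_cheapIdeal σ 1 hf

/-- `A_T (f g) ∈ 𝔠_m` whenever `g ∈ 𝔠_m` (no invariance of `f` needed). -/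
theorem colAvg_mul_mem (T : Finset (Perm (Fin m))) (f : MvPolynomial (Fin m × Fin m) ℂ)
    {g : MvPolynomial (Fin m × Fin m) ℂ} (hg : g ∈ cheapIdeal (Fin m)) : colAvg T (f * g) ∈ cheapIdeal (Fin m) := by
  rw [colAvg_apply]
  exact Ideal.sum_mem _ fun τ _ => by rw [map_mul]; exact Ideal.mul_mem_left _ _ (rename_prodCongr_mem_cheapIdeal 1 τ hg)

/-- A `T`-invariant factor pulls out of `A_T`. -/
theorem colAvg_mul_of_forall_rename_eq (T : Finset (Perm (Fin m))) {f : MvPolynomial (Fin m × Fin m) ℂ}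
    (hf : ∀ τ ∈ T, rename (Equiv.prodCongr (1 : Perm (Fin m)) τ) f = f) (g : MvPolynomial (Fin m × Fin m) ℂ) :
    colAvg T (f * g) = f * colAvg T g := by
  rw [colAvg_apply, colAvg_apply, Finset.mul_sum]
  exact Finset.sum_congr rfl fun τ hτ => by rw [map_mul, hf τ hτ]

/-- `A_T` is invariant under right translation of the argument by `π` when `T π = T`. -/
theorem colAvg_rename_eq (T : Finset (Perm (Fin m))) (π : Perm (Fin m)) (hT : ∀ τ, τ ∈ T ↔ τ * π ∈ T)
    (f : MvPolynomial (Fin m × Fin m) ℂ) :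
    colAvg T (rename (Equiv.prodCongr (1 : Perm (Fin m)) π) f) = colAvg T f := by
  rw [colAvg_apply, colAvg_apply]
  simp_rw [rename_rename]
  refine Finset.sum_equiv (Equiv.mulRight π) (fun τ => hT τ) (fun τ _ => ?_)
  exact congrArg (fun F : Fin m × Fin m → Fin m × Fin m => rename F f) (funext fun ⟨a, b⟩ => rfl)

/-- Row averaging is column averaging conjugated by transposition. -/
theorem rowAvg_eq_transpose (S : Finset (Perm (Fin m))) (f : MvPolynomial (Fin m × Fin m) ℂ) :
    rowAvg S f = rename (Equiv.prodComm (Fin m) (Fin m))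
      (colAvg S (rename (Equiv.prodComm (Fin m) (Fin m)) f)) := by
  rw [rowAvg_apply, colAvg_apply, map_sum]
  refine Finset.sum_congr rfl fun σ _ => ?_
  rw [rename_rename, rename_rename]
  exact congrArg (fun F : Fin m × Fin m → Fin m × Fin m => rename F f) (funext fun ⟨a, b⟩ => rfl)

/-- `B_S ∘ A_T` is the double sum over `S × T`. -/
theorem rowAvg_colAvg (S T : Finset (Perm (Fin m))) (f : MvPolynomial (Fin m × Fin m) ℂ) :
    rowAvg S (colAvg T f) = ∑ σ ∈ S, ∑ τ ∈ T, rename (Equiv.prodCongr σ τ) f := by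
  rw [rowAvg_apply]
  refine Finset.sum_congr rfl fun σ _ => ?_
  rw [colAvg_apply, map_sum]
  refine Finset.sum_congr rfl fun τ _ => ?_
  rw [rename_rename]
  exact congrArg (fun F : Fin m × Fin m → Fin m × Fin m => rename F f) (funext fun ⟨a, b⟩ => rfl)

/-! ## §4 Full symmetrisers of quadrics lie in `𝔠_m` -/

/-- Same column: `A_{𝔖_m}(x_{a,b} x_{c,b}) = #Stab(b) • (XXᵀ)_{a,c} ∈ 𝔠_m`. -/
theorem colAvg_univ_X_mul_X_same (a b c : Fin m) :
    colAvg Finset.univ (X (a, b) * X (c, b)) ∈ cheapIdeal (Fin m) := by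
  rw [colAvg_apply]
  simp_rw [map_mul, rename_one_prodCongr_X]
  show ∑ τ : Perm (Fin m), (fun l => (X (a, l) * X (c, l) : MvPolynomial (Fin m × Fin m) ℂ)) (τ b) ∈ _
  rw [sum_perm_apply_eq_card_smul b (fun l => (X (a, l) * X (c, l) : MvPolynomial (Fin m × Fin m) ℂ))]
  exact nsmul_mem (rowGram_mem a c) _

/-- `A_{𝔖_m}(x_{a,b} x_{c,d}) ∈ 𝔠_m` for every quadric monomial (averaging trick for `b ≠ d`). -/
theorem colAvg_univ_X_mul_X_mem (a b c d : Fin m) :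
    colAvg Finset.univ (X (a, b) * X (c, d)) ∈ cheapIdeal (Fin m) := by
  classical
  by_cases hbd : b = d
  · rw [← hbd]; exact colAvg_univ_X_mul_X_same a b c
  have hb : b ∈ (Finset.univ : Finset (Fin m)) := Finset.mem_univ b
  -- the column average does not depend on the free column `d ≠ b`
  have key : ∀ d' ∈ Finset.univ.erase b,
      colAvg Finset.univ (X (a, b) * X (c, d')) = colAvg Finset.univ (X (a, b) * X (c, d)) := by
    intro d' hd'
    have hd'b : d' ≠ b := (Finset.mem_erase.1 hd').1
    have hswap : rename (Equiv.prodCongr (1 : Perm (Fin m)) (Equiv.swap d d'))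
        (X (a, b) * X (c, d) : MvPolynomial (Fin m × Fin m) ℂ) = X (a, b) * X (c, d') := by
      rw [map_mul, rename_one_prodCongr_X, rename_one_prodCongr_X, Equiv.swap_apply_left,
        Equiv.swap_apply_of_ne_of_ne hbd (Ne.symm hd'b)]
    rw [← hswap, colAvg_rename_eq _ _ (fun τ => by simp) _]
  -- `A(x_{ab} t_c) = A(x_{ab} x_{cb}) + (m - 1) • A(x_{ab} x_{cd})`
  have hsum : colAvg Finset.univ (X (a, b) * rowSum (Fin m) c) = colAvg Finset.univ (X (a, b) * X (c, b)) +
      (Finset.univ.erase b).card • colAvg Finset.univ (X (a, b) * X (c, d)) := by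
    rw [rowSum, Finset.mul_sum, map_sum, ← Finset.add_sum_erase _ _ hb, Finset.sum_congr rfl key,
      Finset.sum_const]
  have hN : ((Finset.univ.erase b).card : ℂ) ≠ 0 := by
    rw [Nat.cast_ne_zero, Finset.card_erase_of_mem hb, Finset.card_univ, Fintype.card_fin]
    have h2 := Finset.card_le_univ ({b, d} : Finset (Fin m))
    rw [Finset.card_eq_two.2 ⟨b, d, hbd, rfl⟩, Fintype.card_fin] at h2
    omega
  refine mem_cheapIdeal_of_smul_mem hN ?_
  have hmem := Ideal.sub_mem _ (colAvg_mul_mem Finset.univ (X (a, b)) (rowSum_mem (n := Fin m) c))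
    (colAvg_univ_X_mul_X_same a b c)
  rwa [hsum, add_sub_cancel_left, ← Nat.cast_smul_eq_nsmul ℂ] at hmem

/-- A quadric is a linear combination of the products `x_{p} x_{q}`. -/
theorem mem_span_X_mul_X {v : MvPolynomial (Fin m × Fin m) ℂ} (hv : v.IsHomogeneous 2) :
    v ∈ Submodule.span ℂ (Set.range fun pq : (Fin m × Fin m) × (Fin m × Fin m) => X pq.1 * X pq.2) := by
  classical
  rw [v.as_sum]
  refine Submodule.sum_mem _ fun d hd => ?_
  have hdeg : d.degree = 2 := by
    by_contra h
    exact (mem_support_iff.1 hd) (hv.coeff_eq_zero h)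
  have hcard : (Finsupp.toMultiset d).card = 2 := by
    rw [Finsupp.card_toMultiset, Finsupp.sum_fintype _ _ (fun _ => rfl)]
    simpa [Finsupp.degree_eq_sum] using hdeg
  obtain ⟨p, q, hpq⟩ := Multiset.card_eq_two.1 hcard
  have hd' : d = Finsupp.single p 1 + Finsupp.single q 1 := by
    rw [← Finsupp.toMultiset_toFinsupp d, hpq, Multiset.insert_eq_cons, ← Multiset.singleton_add, map_add,
      Multiset.toFinsupp_singleton, Multiset.toFinsupp_singleton]
  have hX : (X p * X q : MvPolynomial (Fin m × Fin m) ℂ) = monomial (Finsupp.single p 1 + Finsupp.single q 1) 1 := by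
    simp only [X, monomial_mul, mul_one]
  rw [hd', ← mul_one (coeff (Finsupp.single p 1 + Finsupp.single q 1) v), ← smul_eq_mul, ← smul_monomial, ← hX]
  exact Submodule.smul_mem _ _ (Submodule.subset_span ⟨(p, q), rfl⟩)

/-- ★ `∑_{τ ∈ 𝔖_m} (1 × τ) · v ∈ 𝔠_m` for every quadric `v`. -/
theorem colSym_mem_cheapIdeal {v : MvPolynomial (Fin m × Fin m) ℂ} (hv : v.IsHomogeneous 2) :
    ∑ τ : Perm (Fin m), rename (Equiv.prodCongr (1 : Perm (Fin m)) τ) v ∈ cheapIdeal (Fin m) := by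
  rw [← colAvg_apply]
  refine Submodule.span_induction (p := fun w _ => colAvg Finset.univ w ∈ cheapIdeal (Fin m)) ?_ ?_ ?_ ?_
    (mem_span_X_mul_X hv)
  · rintro _ ⟨⟨⟨a, b⟩, ⟨c, d⟩⟩, rfl⟩
    exact colAvg_univ_X_mul_X_mem a b c d
  · rw [map_zero]; exact Ideal.zero_mem _
  · intro x y _ _ hx hy; rw [map_add]; exact Ideal.add_mem _ hx hy
  · intro r x _ hx; rw [map_smul]; exact Submodule.smul_of_tower_mem _ r hx

/-- ★ `∑_{σ ∈ 𝔖_m} (σ × 1) · v ∈ 𝔠_m` for every quadric `v`. -/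
theorem rowSym_mem_cheapIdeal {v : MvPolynomial (Fin m × Fin m) ℂ} (hv : v.IsHomogeneous 2) :
    ∑ σ : Perm (Fin m), rename (Equiv.prodCongr σ (1 : Perm (Fin m))) v ∈ cheapIdeal (Fin m) := by
  rw [← rowAvg_apply, rowAvg_eq_transpose]
  refine rename_prodComm_mem_cheapIdeal ?_
  rw [colAvg_apply]
  exact colSym_mem_cheapIdeal hv.rename_isHomogeneous

end Summit.ValiantsHypothesis.ValiantsHypothesis.Theorems.EquivariantDialLayersSymmetrisers
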